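import Mathlib
import HarnessLib
import Summits.HubbardSuperconductivity.HubbardSuperconductivity.Theorems.WeakCouplingBCSKlCertTPrimePocketFrame

/-!
# Route `WeakCouplingBCS` — certificate half of stmt-HubbardSuperconductivity-0158, item (N3)′ of «TPRIME-LINDHARD-HS» (pen (R475)(A)), file F1b:
# STRICT CONVEXITY ⇒ GAUSS-MAP INJECTIVITY of the Γ-centred polar chart `kltpPolar tp μ`, and the half-turn symmetry of its frame

Cell `gate-hubbard-kl`, seat p4 (g24); zero kit; no definitions.  Continues `…KlCertTPrimePocketFrame` (frame, normal form
`(ε_x, ε_y)(γθ) = c·(y′, −x′)`, `curvNum = c²·kltpHessForm = c³·(x′y″ − y′x″)`, normal angle `α`) on the Γ-window `|t′| < 1/2`, `−4 − 4t′ < μ < 4t′`: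

* §4 under the CONVEXITY HYPOTHESIS `hN : ∀ θ, 0 < curvNum t′ (x θ) (y θ)` (discharged per cell — for the `(⅛, −3/10)` cell by `Mside_curvNum_neg`
  through the particle–hole map, margin-1's brick (G1)): `0 < kltpHessForm`, `x′y″ − y′x″ > 0`, `α′ > 0`, `α` strictly increasing;
* §5 the half-turn symmetry: `u, u′, u″` are `π`-periodic, the frame `x, y, x′, y′, x″, y″` flips sign, `α(θ + π) = α(θ) + π`; and
  **`kltp_exists_eq_add_int_mul_pi_of_cross_eq_zero`**: PARALLEL GRADIENTS at `γ(θ)`, `γ(φ)` force `φ = θ + jπ` — the Gauss-map injectivity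
  modulo the central symmetry that the pair-energy nondegeneracy (file F2) consumes (twin of `Literature…exists_eq_add_int_mul_pi_of_cross_eq_zero`).

Honest framing: elementary differential geometry of one explicit level curve; nothing here asserts (N3)′, an HS row, a margin, `K₃`, `U₀`, the window
or superconductivity; a Kohn–Luttinger `O(U²)` channel statement is not ODLRO; nothing here proves superconductivity in the Hubbard model.
References: G. Benfatto, A. Giuliani, V. Mastropietro, Ann. Henri Poincaré 7 (2006) 809, §1 (1.5); S. Raghu, S. A. Kivelson, D. J. Scalapino,
Phys. Rev. B 81 (2010) 224505, §II.
-/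

noncomputable section

-- the tree's namespace `Summit.<Summit>.<Problem>.Theorems` repeats the summit name by design (D-0017)
set_option linter.dupNamespace false

namespace Summit.HubbardSuperconductivity.HubbardSuperconductivity.Theorems

open Real Set Filter Literature.MathematicalPhysics.QuantumLattice KlTPrimeConvexity
open scoped Topology

section Window

variable {tp μ : ℝ} (htp : |tp| < 1 / 2) (hμ₁ : -4 - 4 * tp < μ) (hμ₂ : μ < 4 * tp)
include htp hμ₁ hμ₂

/-! ### §4 Under strict convexity: the Gauss map is injective modulo the half turn -/

section Convex

variable (hN : ∀ θ : ℝ, 0 < curvNum tp (kltpX tp μ θ) (kltpY tp μ θ))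
include hN

/-- Strict convexity in Hessian form: `0 < ε_xx x′² + 2ε_xy x′y′ + ε_yy y′²`. [folklore] -/
theorem kltpHessForm_pos (θ : ℝ) : 0 < kltpHessForm tp μ θ := by
  have h := hN θ
  rw [kltp_curvNum_eq htp hμ₁ hμ₂] at h
  exact pos_of_mul_pos_right h (sq_nonneg _)

/-- `x′y″ − y′x″ > 0`. [folklore] -/
theorem kltpCross_pos (θ : ℝ) : 0 < kltpVX tp μ θ * kltpAY tp μ θ - kltpVY tp μ θ * kltpAX tp μ θ := by
  have h := kltpHessForm_pos htp hμ₁ hμ₂ hN θ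
  rw [kltpHessForm_eq_cross htp hμ₁ hμ₂] at h
  exact pos_of_mul_pos_right h (kltpNormalCoeff_pos htp hμ₁ hμ₂ θ).le

/-- `α′ > 0`. [folklore] -/
theorem kltpNormalAngleDeriv_pos (θ : ℝ) : 0 < kltpNormalAngleDeriv tp μ θ := by
  have hu := kltpRadius_pos htp hμ₁ hμ₂ θ
  rw [kltpNormalAngleDeriv, ← kltpCross_eq_polar]
  exact div_pos (kltpCross_pos htp hμ₁ hμ₂ hN θ) (by positivity)

/-- **`α` is strictly increasing.** [folklore] -/
theorem strictMono_kltpNormalAngle : StrictMono (kltpNormalAngle tp μ) :=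
  strictMono_of_deriv_pos fun θ => by
    rw [(hasDerivAt_kltpNormalAngle htp hμ₁ hμ₂ θ).deriv]; exact kltpNormalAngleDeriv_pos htp hμ₁ hμ₂ hN θ

end Convex

/-! ### §5 The half-turn symmetry -/

omit htp hμ₁ hμ₂ in
/-- The ray function is `π`-periodic in the angle (`ε_{t′}` is even). [folklore] -/
theorem kltpRay_add_pi (θ t : ℝ) : kltpRay tp (θ + π) t = kltpRay tp θ t := by
  simp [kltpRay, Real.cos_add_pi, Real.sin_add_pi, mul_neg, Real.cos_neg]

omit htp hμ₁ hμ₂ in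
/-- `∂_tF` is `π`-periodic in the angle. [folklore] -/
theorem kltpRayDt_add_pi (θ t : ℝ) : kltpRayDt tp (θ + π) t = kltpRayDt tp θ t := by
  simp [kltpRayDt, Real.cos_add_pi, Real.sin_add_pi, mul_neg, Real.cos_neg, Real.sin_neg]

omit htp hμ₁ hμ₂ in
/-- `∂_θF` is `π`-periodic in the angle. [folklore] -/
theorem kltpRayDθ_add_pi (θ t : ℝ) : kltpRayDθ tp (θ + π) t = kltpRayDθ tp θ t := by
  simp [kltpRayDθ, Real.cos_add_pi, Real.sin_add_pi, mul_neg, Real.cos_neg, Real.sin_neg]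

/-- **`u(θ + π) = u(θ)`** (central symmetry of the Γ-pocket). [folklore] -/
theorem kltpRadius_add_pi (θ : ℝ) : kltpRadius tp μ (θ + π) = kltpRadius tp μ θ := by
  have hu := isKltpRadius_kltpRadius htp hμ₁ hμ₂ θ
  symm
  refine kltpRadius_unique htp hμ₁ hμ₂ ⟨?_, ?_⟩
  · have hn : ‖dir (θ + π)‖ = ‖dir θ‖ := by rw [norm_dir, norm_dir, Real.cos_add_pi, Real.sin_add_pi, abs_neg, abs_neg]
    rw [hn]; exact hu.1
  · rw [kltpRay_add_pi]; exact hu.2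

/-- `u′(θ + π) = u′(θ)`. [folklore] -/
theorem kltpRadiusDeriv_add_pi (θ : ℝ) : kltpRadiusDeriv tp μ (θ + π) = kltpRadiusDeriv tp μ θ := by
  rw [kltpRadiusDeriv, kltpRadiusDeriv, kltpRadius_add_pi htp hμ₁ hμ₂, kltpRayDθ_add_pi, kltpRayDt_add_pi]

/-- `u″(θ + π) = u″(θ)`. [folklore] -/
theorem kltpRadiusDeriv2_add_pi (θ : ℝ) : kltpRadiusDeriv2 tp μ (θ + π) = kltpRadiusDeriv2 tp μ θ := by
  have hfun : (fun ϑ => kltpRadiusDeriv tp μ (ϑ + π)) = kltpRadiusDeriv tp μ :=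
    funext fun ϑ => kltpRadiusDeriv_add_pi htp hμ₁ hμ₂ ϑ
  have h1 : HasDerivAt (fun ϑ => kltpRadiusDeriv tp μ (ϑ + π)) (kltpRadiusDeriv2 tp μ (θ + π)) θ :=
    (hasDerivAt_kltpRadiusDeriv htp hμ₁ hμ₂ (θ + π)).comp_add_const θ π
  rw [hfun] at h1
  exact h1.unique (hasDerivAt_kltpRadiusDeriv htp hμ₁ hμ₂ θ)

/-- The frame flips under the half turn: `(x, y, x′, y′, x″, y″)(θ + π) = −(…)(θ)`. [folklore] -/
theorem kltpFrame_add_pi (θ : ℝ) :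
    kltpX tp μ (θ + π) = -kltpX tp μ θ ∧ kltpY tp μ (θ + π) = -kltpY tp μ θ ∧
    kltpVX tp μ (θ + π) = -kltpVX tp μ θ ∧ kltpVY tp μ (θ + π) = -kltpVY tp μ θ ∧
    kltpAX tp μ (θ + π) = -kltpAX tp μ θ ∧ kltpAY tp μ (θ + π) = -kltpAY tp μ θ := by
  simp only [kltpX, kltpY, kltpVX, kltpVY, kltpAX, kltpAY, kltpRadius_add_pi htp hμ₁ hμ₂,
    kltpRadiusDeriv_add_pi htp hμ₁ hμ₂, kltpRadiusDeriv2_add_pi htp hμ₁ hμ₂, Real.cos_add_pi, Real.sin_add_pi]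
  refine ⟨by ring, by ring, by ring, by ring, by ring, by ring⟩

/-- **The frame at `θ + jπ` is `±` the frame at `θ`.** [folklore] -/
theorem kltpFrame_add_int_mul_pi (θ : ℝ) (j : ℤ) :
    ∃ e : ℝ, (e = 1 ∨ e = -1) ∧
      kltpX tp μ (θ + j * π) = e * kltpX tp μ θ ∧ kltpY tp μ (θ + j * π) = e * kltpY tp μ θ ∧
      kltpVX tp μ (θ + j * π) = e * kltpVX tp μ θ ∧ kltpVY tp μ (θ + j * π) = e * kltpVY tp μ θ ∧
      kltpAX tp μ (θ + j * π) = e * kltpAX tp μ θ ∧ kltpAY tp μ (θ + j * π) = e * kltpAY tp μ θ := by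
  induction j using Int.induction_on with
  | zero => exact ⟨1, Or.inl rfl, by simp, by simp, by simp, by simp, by simp, by simp⟩
  | succ n ih =>
      obtain ⟨e, he, h1, h2, h3, h4, h5, h6⟩ := ih
      obtain ⟨f1, f2, f3, f4, f5, f6⟩ := kltpFrame_add_pi htp hμ₁ hμ₂ (θ + n * π)
      push_cast at h1 h2 h3 h4 h5 h6
      refine ⟨-e, by rcases he with h | h <;> simp [h], ?_, ?_, ?_, ?_, ?_, ?_⟩ <;>
        push_cast <;> rw [show θ + (n + 1) * π = θ + n * π + π by ring]
      · rw [f1, h1]; ring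
      · rw [f2, h2]; ring
      · rw [f3, h3]; ring
      · rw [f4, h4]; ring
      · rw [f5, h5]; ring
      · rw [f6, h6]; ring
  | pred n ih =>
      obtain ⟨e, he, h1, h2, h3, h4, h5, h6⟩ := ih
      obtain ⟨f1, f2, f3, f4, f5, f6⟩ := kltpFrame_add_pi htp hμ₁ hμ₂ (θ + (-(n : ℝ) - 1) * π)
      have hs : θ + (-(n : ℝ) - 1) * π + π = θ + -(n : ℝ) * π := by ring
      rw [hs] at f1 f2 f3 f4 f5 f6
      push_cast at h1 h2 h3 h4 h5 h6
      refine ⟨-e, by rcases he with h | h <;> simp [h], ?_, ?_, ?_, ?_, ?_, ?_⟩ <;> push_cast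
      · linarith
      · linarith
      · linarith
      · linarith
      · linarith
      · linarith

/-- `α(θ + π) = α(θ) + π`. [folklore] -/
theorem kltpNormalAngle_add_pi (θ : ℝ) : kltpNormalAngle tp μ (θ + π) = kltpNormalAngle tp μ θ + π := by
  rw [kltpNormalAngle, kltpNormalAngle, kltpRadius_add_pi htp hμ₁ hμ₂, kltpRadiusDeriv_add_pi htp hμ₁ hμ₂]
  ring

/-- `α(θ + jπ) = α(θ) + jπ` for every integer `j`. [folklore] -/
theorem kltpNormalAngle_add_int_mul_pi (θ : ℝ) (j : ℤ) :
    kltpNormalAngle tp μ (θ + j * π) = kltpNormalAngle tp μ θ + j * π := by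
  induction j using Int.induction_on with
  | zero => simp
  | succ n ih =>
      have h := kltpNormalAngle_add_pi htp hμ₁ hμ₂ (θ + n * π)
      push_cast at ih h ⊢
      rw [show θ + (n + 1) * π = θ + n * π + π by ring, h, ih]; ring
  | pred n ih =>
      have h := kltpNormalAngle_add_pi htp hμ₁ hμ₂ (θ + (-(n : ℝ) - 1) * π)
      push_cast at ih h ⊢
      rw [show θ + (-(n : ℝ) - 1) * π + π = θ + -(n : ℝ) * π by ring] at h
      linarith

/-- **GAUSS-MAP INJECTIVITY MODULO THE HALF TURN**: under strict convexity, if the gradients `(ε_x, ε_y)` at `γ(θ)` and at `γ(φ)` are parallel then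
`φ = θ + jπ` for some integer `j`. [cite: BenfattoGiulianiMastropietro2006, §1 (1.5)] -/
theorem kltp_exists_eq_add_int_mul_pi_of_cross_eq_zero (hN : ∀ θ : ℝ, 0 < curvNum tp (kltpX tp μ θ) (kltpY tp μ θ)) {θ φ : ℝ}
    (h : dx tp (kltpX tp μ θ) (kltpY tp μ θ) * dy tp (kltpX tp μ φ) (kltpY tp μ φ) -
      dy tp (kltpX tp μ θ) (kltpY tp μ θ) * dx tp (kltpX tp μ φ) (kltpY tp μ φ) = 0) :
    ∃ j : ℤ, φ = θ + j * π := by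
  obtain ⟨ρ₁, hρ₁, hx₁, hy₁⟩ := kltp_dxdy_eq_polar htp hμ₁ hμ₂ θ
  obtain ⟨ρ₂, hρ₂, hx₂, hy₂⟩ := kltp_dxdy_eq_polar htp hμ₁ hμ₂ φ
  rw [hx₁, hy₁, hx₂, hy₂] at h
  have hsin : Real.sin (kltpNormalAngle tp μ φ - kltpNormalAngle tp μ θ) = 0 := by
    rw [Real.sin_sub]
    have : ρ₁ * ρ₂ * (Real.sin (kltpNormalAngle tp μ φ) * Real.cos (kltpNormalAngle tp μ θ) -
        Real.cos (kltpNormalAngle tp μ φ) * Real.sin (kltpNormalAngle tp μ θ)) = 0 := by linear_combination h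
    rcases mul_eq_zero.1 this with h0 | h0
    · exact absurd h0 (mul_pos hρ₁ hρ₂).ne'
    · exact h0
  obtain ⟨j, hj⟩ := Real.sin_eq_zero_iff.1 hsin
  refine ⟨j, ?_⟩
  have hα : kltpNormalAngle tp μ φ = kltpNormalAngle tp μ (θ + j * π) := by
    rw [kltpNormalAngle_add_int_mul_pi htp hμ₁ hμ₂]; linarith
  exact (strictMono_kltpNormalAngle htp hμ₁ hμ₂ hN).injective hα

end Window

end Summit.HubbardSuperconductivity.HubbardSuperconductivity.Theorems

end
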